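import Mathlib.Analysis.InnerProductSpace.Dual
import Mathlib.Analysis.InnerProductSpace.Projection.Submodule
import HarnessLib

/-!
# Diagonal extraction, limits from a dense set, and weak limits in a Hilbert space

Analysis/FunctionSpaces support file: the elementary compactness tools of **Leray's passage to
the limit** (Leray 1934, §13, "procédé diagonal de Cantor", and §§28–29; Ożański–Pooley 2018,
proof of Thm. 6.37, Step 1 and the first paragraph of Step 3, with Helly's Thm. 6.38;
Robinson–Rodrigo–Sadowski 2016, Thm. 4.11 and Exercises 4.3–4.4), isolated as generic lemmas of
real and functional analysis so that the limit half `Literature.Analysis.FluidPDE.leray_regularised_limit` of Leray's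
existence theorem (`Literature/Analysis/FluidPDE/NSLerayRegularised`) — and any other
"bounded sequence, countably many pairings" argument — can use them:

* `Literature.Analysis.FunctionSpaces.exists_strictMono_forall_tendsto` (**diagonal extraction**): countably many sequences with
  values in fixed compact balls of a proper metric space have a common convergent subsequence
  (Tychonoff on the countable product and sequential compactness; the "diagonal argument" of
  OP 2018, (6.90)/(6.93)); real-valued form `Literature.Analysis.FunctionSpaces.exists_strictMono_forall_tendsto_real`.
* `Literature.Analysis.FunctionSpaces.forall_exists_tendsto_of_subset_closure` (**from a dense set by equicontinuity**): if the
  sequences `n ↦ x n d` converge for `d` in a set `D` and the family `(x n)` is uniformly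
  equicontinuous between points of `S` and of `D`, then `n ↦ x n t` converges for every
  `t ∈ S ⊆ closure D` (values in a complete space; OP 2018, after (6.93): "from the timewise uniform
  continuity … they converge for every pair `t₁, t₂ ≥ 0`"); `Literature.Analysis.FunctionSpaces.dist_lim_le_of_dist_le` transfers
  a modulus of continuity to the limits.
* `Literature.Analysis.FunctionSpaces.exists_mem_tendsto_inner_of_subset_closure_span` (**weak limits in a Hilbert space**): a
  bounded sequence in a closed subspace `K` whose pairings with the elements of a set `D ⊆ H`
  spanning a dense subspace of `K` converge has a weak limit `w ∈ K`, `‖w‖ ≤ sup ‖vₙ‖`, tested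
  against *every* vector (density, the orthogonal projection onto `K`, and the Riesz representation
  `InnerProductSpace.toDual`; OP 2018, (6.96)–(6.97) and footnote 36: "`∫ u_εₙ(t)·ψ` converge for
  all `ψ` … together with `‖u_εₙ(t)‖ ≤ ‖u₀‖` implies `u_εₙ(t) ⇀ u(t)` for some `u(t) ∈ H`";
  Leray 1934, §28), with the lower semicontinuity of the norm
  `Literature.Analysis.FunctionSpaces.norm_le_of_tendsto_inner_of_eventually_norm_le` (OP (6.100)).
* `Literature.Analysis.FunctionSpaces.exists_countable_forall_tendsto_of_antitoneOn` (**Helly's selection for monotone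
  functions, the form used by Leray**): if each `g n` is non-increasing on `[0, ∞)` and
  `g n q → L q` on a set `D` meeting every interval of `[0, ∞)`, then off a *countable* set of
  times `t > 0` the full sequence `g n t` converges (OP 2018, Thm. 6.38 and (6.90): the kinetic
  energies `‖u_ε(t)‖²` are non-increasing, converge at rational times after a diagonal
  extraction, hence at every continuity point of the monotone limit; Leray 1934, §29).

## Mathlib search

Mathlib (this pin) has the ingredients — `IsCompact.tendsto_subseq`, `isCompact_univ_pi`
(Tychonoff), first countability of countable products, `cauchySeq_tendsto_of_complete`,
`Submodule.starProjection` / `Submodule.orthogonal_orthogonal`, `InnerProductSpace.toDual`,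
`Set.PairwiseDisjoint.countable_of_isOpen`, `Monotone.countable_not_continuousAt` — but not these
packaged statements: the closest are `EquicontinuousAt.tendsto_of_mem_closure` (which presupposes
the limit function and its limit at the point) and `BoundedContinuousFunction.arzela_ascoli`
(compact domain). Searched `diagonal`, `tendsto_subseq`, `Helly`, `weak limit`/`WeakSpace` in
`Topology/`, `Analysis/InnerProductSpace/`, `Analysis/Normed/`: no Hilbert-space statement
producing a weak limit from pairings on a dense set.

## References

* J. Leray, *Sur le mouvement d'un liquide visqueux emplissant l'espace*, Acta Math. 63 (1934),
  §13 (faible convergence en moyenne, procédé diagonal), §§28–29.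
* W. S. Ożański, B. C. Pooley, *Leray's fundamental work on the Navier–Stokes equations*, in:
  Partial Differential Equations in Fluid Mechanics, LMS Lecture Note Ser. 452 (CUP 2018), proof of
  Thm. 6.37, Step 1 ((6.90)–(6.97)), Step 3 (first paragraph, (6.100)), Thm. 6.38 (Helly 1912).
* J. C. Robinson, J. L. Rodrigo, W. Sadowski, *The three-dimensional Navier–Stokes equations*
  (CUP 2016), Thm. 4.11, Exercises 4.3–4.4, Lemma A.20.
-/

noncomputable section

open Filter Topology Set Metric

namespace Literature.Analysis.FunctionSpaces

/-! ### Diagonal extraction -/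

section Diagonal

/-- **Diagonal extraction.** Let `ι` be countable and `x n : ι → F` a sequence of families in a
proper metric space, each coordinate staying in a fixed closed ball: `x n i ∈ B̄(c i, R i)` for all
`n`. Then some subsequence converges in every coordinate (Tychonoff: the product of the balls is
compact in the first-countable space `ι → F`, so it is sequentially compact). This is Cantor's
diagonal procedure (Leray 1934, §13; Ożański–Pooley 2018, (6.90)/(6.93)). [cite: OzanskiPooley2018, proof of Thm. 6.37 Step 1 (6.93)] -/
theorem exists_strictMono_forall_tendsto {ι : Type*} [Countable ι] {F : Type*}
    [PseudoMetricSpace F] [ProperSpace F] (x : ℕ → ι → F)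
    (hb : ∀ i, ∃ (c : F) (R : ℝ), ∀ n, x n i ∈ closedBall c R) :
    ∃ φ : ℕ → ℕ, StrictMono φ ∧ ∀ i, ∃ l, Tendsto (fun n => x (φ n) i) atTop (𝓝 l) := by
  choose c R hcR using hb
  let s : Set (ι → F) := Set.pi univ fun i => closedBall (c i) (R i)
  have hs : IsCompact s := isCompact_univ_pi fun i => isCompact_closedBall _ _
  have hx : ∀ n, x n ∈ s := fun n => mem_univ_pi.2 fun i => hcR i n
  obtain ⟨a, -, φ, hφ, hlim⟩ := hs.tendsto_subseq hx
  rw [tendsto_pi_nhds] at hlim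
  exact ⟨φ, hφ, fun i => ⟨a i, hlim i⟩⟩

/-- **Diagonal extraction, real-valued form**: countably many real sequences, the `i`-th bounded
by `R i` in absolute value, have a common convergent subsequence (Leray 1934, §13;
Ożański–Pooley 2018, (6.90)/(6.93)). [cite: OzanskiPooley2018, proof of Thm. 6.37 Step 1 (6.93)] -/
theorem exists_strictMono_forall_tendsto_real {ι : Type*} [Countable ι] (x : ℕ → ι → ℝ)
    (hb : ∀ i, ∃ R : ℝ, ∀ n, |x n i| ≤ R) :
    ∃ φ : ℕ → ℕ, StrictMono φ ∧ ∀ i, ∃ l, Tendsto (fun n => x (φ n) i) atTop (𝓝 l) := by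
  refine exists_strictMono_forall_tendsto x fun i => ?_
  obtain ⟨R, hR⟩ := hb i
  exact ⟨0, R, fun n => by simpa [mem_closedBall, Real.dist_eq] using hR n⟩

end Diagonal

/-! ### Limits at all points from limits on a dense set, by equicontinuity -/

section Dense

variable {X F : Type*} [PseudoMetricSpace X] [PseudoMetricSpace F]

/-- **Convergence extends from a dense set under uniform equicontinuity.** Let `x n : X → F`
(`F` complete) converge pointwise on `D`, and suppose that for every `ε > 0` there is `δ > 0` with
`dist (x n t) (x n d) < ε` whenever `t ∈ S`, `d ∈ D`, `dist t d < δ`, uniformly in `n`. Then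
`n ↦ x n t` converges for every `t ∈ S ⊆ closure D` (it is Cauchy: `ε/3` through a nearby `d`).
This is the step "(6.93) at rational times, hence at every time by the timewise uniform
continuity" of Ożański–Pooley 2018, and RRS 2016, Exercise 4.4. [cite: OzanskiPooley2018, proof of Thm. 6.37 Step 1, after (6.93)] -/
theorem forall_exists_tendsto_of_subset_closure [CompleteSpace F] {x : ℕ → X → F}
    {S D : Set X} (hSD : S ⊆ closure D)
    (hconv : ∀ d ∈ D, ∃ l, Tendsto (fun n => x n d) atTop (𝓝 l))
    (heq : ∀ ε, 0 < ε → ∃ δ, 0 < δ ∧ ∀ n, ∀ t ∈ S, ∀ d ∈ D,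
      dist t d < δ → dist (x n t) (x n d) < ε) :
    ∀ t ∈ S, ∃ l, Tendsto (fun n => x n t) atTop (𝓝 l) := by
  intro t ht
  refine cauchySeq_tendsto_of_complete (Metric.cauchySeq_iff.2 fun ε hε => ?_)
  obtain ⟨δ, hδ, hmod⟩ := heq (ε / 3) (by positivity)
  obtain ⟨d, hd, htd⟩ := Metric.mem_closure_iff.1 (hSD ht) δ hδ
  obtain ⟨l, hl⟩ := hconv d hd
  obtain ⟨N, hN⟩ := Metric.cauchySeq_iff.1 hl.cauchySeq (ε / 3) (by positivity)
  refine ⟨N, fun m hm n hn => ?_⟩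
  calc dist (x m t) (x n t)
      ≤ dist (x m t) (x m d) + dist (x m d) (x n d) + dist (x n d) (x n t) := dist_triangle4 _ _ _ _
    _ < ε / 3 + ε / 3 + ε / 3 := by
        refine add_lt_add (add_lt_add (hmod m t ht d hd htd) (hN m hm n hn)) ?_
        rw [dist_comm]
        exact hmod n t ht d hd htd
    _ = ε := by ring

omit [PseudoMetricSpace X] in
/-- A uniform bound on the distances of two convergent sequences passes to their limits:
`dist (x n) (y n) ≤ ε` for all `n` gives `dist lx ly ≤ ε` (continuity of `dist`). Used to hand
the modulus of equicontinuity of `t ↦ ⟪U n t, a⟫` to the limit `t ↦ ⟪u t, a⟫`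
(Ożański–Pooley 2018, Cor. 6.36: weak `L²` continuity of the limit). [folklore] -/
theorem dist_lim_le_of_dist_le {x y : ℕ → F} {lx ly : F} {ε : ℝ} (hx : Tendsto x atTop (𝓝 lx))
    (hy : Tendsto y atTop (𝓝 ly)) (h : ∀ n, dist (x n) (y n) ≤ ε) : dist lx ly ≤ ε :=
  le_of_tendsto (hx.dist hy) (Eventually.of_forall h)

end Dense

/-! ### Weak limits in a Hilbert space from pairings on a dense set -/

section Hilbert

variable {H : Type*} [NormedAddCommGroup H] [InnerProductSpace ℝ H]

local notation "⟪" x ", " y "⟫" => @inner ℝ H _ x y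

/-- Convergence of the pairings `⟪v n, d⟫` for `d ∈ D` propagates to the linear span of `D`
(limits of sums and scalar multiples). [folklore] -/
theorem forall_span_exists_tendsto_inner {D : Set H} {v : ℕ → H}
    (hconv : ∀ d ∈ D, ∃ l, Tendsto (fun n => ⟪v n, d⟫) atTop (𝓝 l)) :
    ∀ d ∈ Submodule.span ℝ D, ∃ l, Tendsto (fun n => ⟪v n, d⟫) atTop (𝓝 l) := by
  intro d hd
  induction hd using Submodule.span_induction with
  | mem d hd => exact hconv d hd
  | zero => exact ⟨0, by simp⟩
  | add a b _ _ ha hb =>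
    obtain ⟨l₁, h₁⟩ := ha
    obtain ⟨l₂, h₂⟩ := hb
    exact ⟨l₁ + l₂, by simpa only [inner_add_right] using h₁.add h₂⟩
  | smul c a _ ha =>
    obtain ⟨l, h⟩ := ha
    exact ⟨c * l, by simpa only [real_inner_smul_right] using h.const_mul c⟩

/-- For a **bounded** sequence, convergence of the pairings `⟪v n, d⟫`, `d ∈ D`, propagates to
every `z` in the closure of the span of `D` (equicontinuity `|⟪v n, z⟫ − ⟪v n, d⟫| ≤ M ‖z − d‖`
and `forall_exists_tendsto_of_subset_closure`; Ożański–Pooley 2018, the `ε/3` argument around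
(6.95)). [cite: OzanskiPooley2018, proof of Thm. 6.37 Step 1 (6.94)–(6.96)] -/
theorem exists_tendsto_inner_of_mem_closure_span {D : Set H} {v : ℕ → H} {M : ℝ}
    (hM : ∀ n, ‖v n‖ ≤ M)
    (hconv : ∀ d ∈ D, ∃ l, Tendsto (fun n => ⟪v n, d⟫) atTop (𝓝 l)) {z : H}
    (hz : z ∈ closure (Submodule.span ℝ D : Set H)) :
    ∃ l, Tendsto (fun n => ⟪v n, z⟫) atTop (𝓝 l) := by
  have hM0 : 0 ≤ M := (norm_nonneg _).trans (hM 0)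
  refine forall_exists_tendsto_of_subset_closure (x := fun n z => ⟪v n, z⟫)
    (S := closure (Submodule.span ℝ D : Set H)) (D := (Submodule.span ℝ D : Set H)) subset_rfl
    (forall_span_exists_tendsto_inner hconv) (fun ε hε => ?_) z hz
  refine ⟨ε / (M + 1), by positivity, fun n t _ d _ htd => ?_⟩
  rw [Real.dist_eq, ← inner_sub_right]
  calc |⟪v n, t - d⟫| ≤ ‖v n‖ * ‖t - d‖ := abs_real_inner_le_norm _ _
    _ ≤ M * (ε / (M + 1)) := by
        rw [← dist_eq_norm]
        exact mul_le_mul (hM n) htd.le dist_nonneg hM0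
    _ < ε := by
        rw [mul_div_assoc']
        rw [div_lt_iff₀ (by positivity)]
        nlinarith

/-- **Weak limits from pairings on a dense set** (Leray 1934, §28; Ożański–Pooley 2018,
(6.96)–(6.97) with footnote 36; RRS 2016, Exercise 4.3). Let `K` be a closed subspace of a real
Hilbert space `H`, `D ⊆ H` a set whose span has closure containing `K`, and `v n ∈ K` a sequence
with `‖v n‖ ≤ M` such that `⟪v n, d⟫` converges for every `d ∈ D`. Then there is `w ∈ K` with
`‖w‖ ≤ M` and `⟪v n, z⟫ → ⟪w, z⟫` for **every** `z ∈ H`. Proof: for `z ∈ K` the pairings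
converge by `exists_tendsto_inner_of_mem_closure_span`; for general `z`,
`⟪v n, z⟫ = ⟪v n, P_K z⟫` (`v n ∈ K`, `z − P_K z ∈ Kᗮ`); the limit functional is linear and bounded
by `M‖z‖`, so it is `⟪w, ·⟫` for some `w` with `‖w‖ ≤ M` (Riesz, `InnerProductSpace.toDual`), and
`w ∈ Kᗮᗮ = K` because the pairings with `Kᗮ` vanish identically. [cite: OzanskiPooley2018, proof of Thm. 6.37 Step 1 (6.96)–(6.97)] -/
theorem exists_mem_tendsto_inner_of_subset_closure_span [CompleteSpace H] (K : Submodule ℝ H)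
    (hK : IsClosed (K : Set H)) {D : Set H}
    (hD : (K : Set H) ⊆ closure (Submodule.span ℝ D : Set H)) {v : ℕ → H} (hv : ∀ n, v n ∈ K)
    {M : ℝ} (hM : ∀ n, ‖v n‖ ≤ M)
    (hconv : ∀ d ∈ D, ∃ l, Tendsto (fun n => ⟪v n, d⟫) atTop (𝓝 l)) :
    ∃ w ∈ K, ‖w‖ ≤ M ∧ ∀ z, Tendsto (fun n => ⟪v n, z⟫) atTop (𝓝 ⟪w, z⟫) := by
  haveI : CompleteSpace K := hK.completeSpace_coe
  have hM0 : 0 ≤ M := (norm_nonneg _).trans (hM 0)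
  -- the pairings converge for every `z`: reduce to `P_K z ∈ K`
  have hall : ∀ z, ∃ l, Tendsto (fun n => ⟪v n, z⟫) atTop (𝓝 l) := by
    intro z
    obtain ⟨l, hl⟩ := exists_tendsto_inner_of_mem_closure_span hM hconv
      (hD (K.starProjection_apply_mem z))
    refine ⟨l, ?_⟩
    have heq : ∀ n, ⟪v n, z⟫ = ⟪v n, K.starProjection z⟫ := fun n => by
      have h0 : ⟪v n, z - K.starProjection z⟫ = 0 :=
        K.sub_starProjection_mem_orthogonal z (v n) (hv n)
      rwa [inner_sub_right, sub_eq_zero] at h0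
    simp_rw [heq]
    exact hl
  choose ℓ hℓ using hall
  -- the limit functional is linear and bounded by `M`
  have hadd : ∀ z₁ z₂, ℓ (z₁ + z₂) = ℓ z₁ + ℓ z₂ := fun z₁ z₂ =>
    tendsto_nhds_unique (hℓ _) (by simpa only [inner_add_right] using (hℓ z₁).add (hℓ z₂))
  have hsmul : ∀ (c : ℝ) z, ℓ (c • z) = c * ℓ z := fun c z =>
    tendsto_nhds_unique (hℓ _) (by simpa only [real_inner_smul_right] using (hℓ z).const_mul c)
  have hbd : ∀ z, |ℓ z| ≤ M * ‖z‖ := fun z =>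
    le_of_tendsto ((continuous_abs.tendsto _).comp (hℓ z)) (Eventually.of_forall fun n =>
      (abs_real_inner_le_norm _ _).trans (mul_le_mul_of_nonneg_right (hM n) (norm_nonneg _)))
  let L : H →ₗ[ℝ] ℝ :=
    { toFun := ℓ
      map_add' := hadd
      map_smul' := fun c z => by simpa using hsmul c z }
  let Lc : H →L[ℝ] ℝ := L.mkContinuous M fun z => by
    change ‖ℓ z‖ ≤ M * ‖z‖
    rw [Real.norm_eq_abs]
    exact hbd z
  set w : H := (InnerProductSpace.toDual ℝ H).symm Lc with hw_def
  have hw : ∀ z, ⟪w, z⟫ = ℓ z := fun z => by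
    rw [hw_def, InnerProductSpace.toDual_symm_apply]
    rfl
  refine ⟨w, ?_, ?_, fun z => by rw [hw]; exact hℓ z⟩
  · -- `w ∈ Kᗮᗮ = K`
    rw [← Submodule.orthogonal_orthogonal K]
    intro z hz
    rw [real_inner_comm, hw]
    have h0 : ∀ n, ⟪v n, z⟫ = 0 := fun n => hz (v n) (hv n)
    exact tendsto_nhds_unique (hℓ z) (by simp [h0])
  · -- `‖w‖ = ‖Lc‖ ≤ M`
    rw [hw_def, LinearIsometryEquiv.norm_map]
    exact L.mkContinuous_norm_le hM0 _

/-- **Lower semicontinuity of the norm under weak convergence**, in the form "an eventual bound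
`‖v n‖ ≤ c` passes to the weak limit": if `⟪v n, z⟫ → ⟪w, z⟫` for every `z` then `‖w‖ ≤ c`
(`‖w‖² = lim ⟪v n, w⟫ ≤ c‖w‖`; Ożański–Pooley 2018, (6.100): "`‖u(t)‖ ≤ lim inf ‖u_εₙ(t)‖` by
the property of weak limits"; RRS 2016, Lemma A.20). [cite: OzanskiPooley2018, proof of Thm. 6.37 Step 3 (6.100)] -/
theorem norm_le_of_tendsto_inner_of_eventually_norm_le {v : ℕ → H} {w : H} {c : ℝ}
    (h : ∀ z, Tendsto (fun n => ⟪v n, z⟫) atTop (𝓝 ⟪w, z⟫)) (hc : ∀ᶠ n in atTop, ‖v n‖ ≤ c) :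
    ‖w‖ ≤ c := by
  have hc0 : 0 ≤ c := by
    obtain ⟨n, hn⟩ := hc.exists
    exact (norm_nonneg _).trans hn
  have hsq : ‖w‖ * ‖w‖ ≤ c * ‖w‖ := by
    rw [← real_inner_self_eq_norm_mul_norm]
    refine le_of_tendsto (h w) ?_
    filter_upwards [hc] with n hn
    exact (real_inner_le_norm _ _).trans (mul_le_mul_of_nonneg_right hn (norm_nonneg _))
  rcases (norm_nonneg w).eq_or_lt with hw | hw
  · rw [← hw]; exact hc0
  · exact le_of_mul_le_mul_right hsq hw

/-- **Weak convergence plus convergence of the norms is strong convergence** in a real inner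
product space: `⟪v n, w⟫ → ‖w‖²` and `limsup ‖v n‖² ≤ ‖w‖²` (in `ε`-form) give `v n → w`
(`‖v n − w‖² = ‖v n‖² − 2⟪v n, w⟫ + ‖w‖²`; Leray 1934, §13, "critère de forte convergence"
p. 200; Ożański–Pooley 2018, Step 3: "weak convergence together with the convergence of the norms
is equivalent to strong convergence"; RRS 2016, Lemma A.20). [cite: OzanskiPooley2018, proof of Thm. 6.37 Step 3 (6.99)] -/
theorem tendsto_of_tendsto_inner_self_of_norm_sq_le {ι : Type*} {l : Filter ι} {v : ι → H}
    {w : H} (hinner : Tendsto (fun i => ⟪v i, w⟫) l (𝓝 (‖w‖ ^ 2)))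
    (hnorm : ∀ ε, 0 < ε → ∀ᶠ i in l, ‖v i‖ ^ 2 ≤ ‖w‖ ^ 2 + ε) :
    Tendsto v l (𝓝 w) := by
  rw [tendsto_iff_norm_sub_tendsto_zero]
  have hsq : Tendsto (fun i => ‖v i - w‖ ^ 2) l (𝓝 0) := by
    rw [Metric.tendsto_nhds]
    intro ε hε
    have h1 := hnorm (ε / 4) (by positivity)
    have h2 : ∀ᶠ i in l, ‖w‖ ^ 2 - ε / 4 < ⟪v i, w⟫ :=
      hinner.eventually (lt_mem_nhds (by linarith))
    filter_upwards [h1, h2] with i hi1 hi2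
    rw [Real.dist_eq, sub_zero, abs_of_nonneg (sq_nonneg _), norm_sub_sq_real]
    nlinarith [sq_nonneg ‖v i - w‖, norm_sub_sq_real (v i) w]
  have h := hsq.sqrt
  simpa [Real.sqrt_sq (norm_nonneg _)] using h

end Hilbert

/-! ### Helly's selection for monotone functions (Leray's form) -/

section Helly

/-- **Convergence off a countable set for non-increasing functions** (Helly 1912;
Ożański–Pooley 2018, Thm. 6.38 and its use in (6.90); Leray 1934, §29). Let `g n : ℝ → ℝ` be
non-increasing on `[0, ∞)` and let `g n q → L q` for every `q ≥ 0` in a set `D` that meets every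
open interval of `[0, ∞)` (e.g. the nonnegative rationals, after a diagonal extraction). Then
there is a **countable** set `J` such that `n ↦ g n t` converges for every `t > 0` off `J`.
Proof: with `a t = inf_{q<t} L q` and `b t = sup_{q>t} L q` one has
`b t ≤ lim inf g n t ≤ lim sup g n t ≤ a t`; the jump set `J = {t : b t < a t}` carries the pairwise
disjoint nonempty open intervals `(b t, a t)` (a point of `D` separates two times), hence is
countable (`Set.PairwiseDisjoint.countable_of_isOpen`); off `J` the squeeze gives convergence to
`a t = b t`. [cite: OzanskiPooley2018, Thm. 6.38 and (6.90)] -/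
theorem exists_countable_forall_tendsto_of_antitoneOn {g : ℕ → ℝ → ℝ} {D : Set ℝ}
    (hD : ∀ a b : ℝ, 0 ≤ a → a < b → ∃ q ∈ D, a < q ∧ q < b)
    (hg : ∀ n, AntitoneOn (g n) (Ici 0)) {L : ℝ → ℝ}
    (hL : ∀ q ∈ D, 0 ≤ q → Tendsto (fun n => g n q) atTop (𝓝 (L q))) :
    ∃ J : Set ℝ, J.Countable ∧
      ∀ t, 0 < t → t ∉ J → ∃ l, Tendsto (fun n => g n t) atTop (𝓝 l) := by
  -- `L` is non-increasing along `D ∩ [0, ∞)`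
  have hLanti : ∀ q ∈ D, ∀ q' ∈ D, 0 ≤ q → q ≤ q' → L q' ≤ L q := fun q hq q' hq' h0 hqq' =>
    le_of_tendsto_of_tendsto (hL q' hq' (h0.trans hqq')) (hL q hq h0)
      (Eventually.of_forall fun n => hg n h0 (h0.trans hqq') hqq')
  -- values of `L` to the left / right of `t`
  let A : ℝ → Set ℝ := fun t => {x | ∃ q ∈ D, 0 ≤ q ∧ q < t ∧ x = L q}
  let B : ℝ → Set ℝ := fun t => {x | ∃ q ∈ D, t < q ∧ x = L q}
  have hAne : ∀ t, 0 < t → (A t).Nonempty := fun t ht => by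
    obtain ⟨q, hq, h0q, hqt⟩ := hD 0 t le_rfl ht
    exact ⟨L q, q, hq, h0q.le, hqt, rfl⟩
  have hBne : ∀ t, 0 < t → (B t).Nonempty := fun t ht => by
    obtain ⟨q, hq, htq, -⟩ := hD t (t + 1) ht.le (lt_add_one t)
    exact ⟨L q, q, hq, htq, rfl⟩
  have hBA : ∀ t, ∀ y ∈ B t, ∀ x ∈ A t, y ≤ x := by
    rintro t y ⟨q', hq', htq', rfl⟩ x ⟨q, hq, h0q, hqt, rfl⟩
    exact hLanti q hq q' hq' h0q (hqt.le.trans htq'.le)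
  have hAbdd : ∀ t, 0 < t → BddBelow (A t) := fun t ht => by
    obtain ⟨y, hy⟩ := hBne t ht
    exact ⟨y, fun x hx => hBA t y hy x hx⟩
  have hBbdd : ∀ t, 0 < t → BddAbove (B t) := fun t ht => by
    obtain ⟨x, hx⟩ := hAne t ht
    exact ⟨x, fun y hy => hBA t y hy x hx⟩
  let a : ℝ → ℝ := fun t => sInf (A t)
  let b : ℝ → ℝ := fun t => sSup (B t)
  have hba : ∀ t, 0 < t → b t ≤ a t := fun t ht =>
    le_csInf (hAne t ht) fun x hx => csSup_le (hBne t ht) fun y hy => hBA t y hy x hx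
  -- the jump set and its countability
  refine ⟨{t | 0 < t ∧ b t < a t}, ?_, ?_⟩
  · refine Set.PairwiseDisjoint.countable_of_isOpen (s := fun t => Ioo (b t) (a t)) ?_
      (fun t _ => isOpen_Ioo) (fun t ht => nonempty_Ioo.2 ht.2)
    intro t₁ ht₁ t₂ ht₂ hne
    -- a point of `D` strictly between the two times separates the intervals
    have key : ∀ {s₁ s₂ : ℝ}, 0 < s₁ → 0 < s₂ → s₁ < s₂ → a s₂ ≤ b s₁ := by
      intro s₁ s₂ hs₁ hs₂ h12
      obtain ⟨q, hq, h1q, hq2⟩ := hD s₁ s₂ hs₁.le h12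
      have hqA : L q ∈ A s₂ := ⟨q, hq, hs₁.le.trans h1q.le, hq2, rfl⟩
      have hqB : L q ∈ B s₁ := ⟨q, hq, h1q, rfl⟩
      exact (csInf_le (hAbdd s₂ hs₂) hqA).trans (le_csSup (hBbdd s₁ hs₁) hqB)
    rcases lt_or_gt_of_ne hne with h | h
    · refine disjoint_left.2 fun z hz₁ hz₂ => ?_
      exact (lt_irrefl z) ((hz₂.2.trans_le (key ht₁.1 ht₂.1 h)).trans hz₁.1)
    · refine disjoint_left.2 fun z hz₁ hz₂ => ?_
      exact (lt_irrefl z) ((hz₁.2.trans_le (key ht₂.1 ht₁.1 h)).trans hz₂.1)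
  · -- off the jump set: squeeze between rational values from the left and from the right
    intro t ht htJ
    have hab : a t = b t :=
      le_antisymm (not_lt.1 fun h => htJ ⟨ht, h⟩) (hba t ht)
    refine ⟨a t, tendsto_order.2 ⟨fun x hx => ?_, fun x hx => ?_⟩⟩
    · -- `x < a t = b t`: some `q' > t` has `x < L q'`, and `g n q' ≤ g n t`
      rw [hab] at hx
      obtain ⟨y, ⟨q', hq', htq', rfl⟩, hxy⟩ := exists_lt_of_lt_csSup (hBne t ht) hx
      have h0q' : 0 ≤ q' := ht.le.trans htq'.le
      filter_upwards [(hL q' hq' h0q').eventually (lt_mem_nhds hxy)] with n hn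
      exact hn.trans_le (hg n ht.le h0q' htq'.le)
    · -- `a t < x`: some `q < t` has `L q < x`, and `g n t ≤ g n q`
      obtain ⟨y, ⟨q, hq, h0q, hqt, rfl⟩, hyx⟩ := exists_lt_of_csInf_lt (hAne t ht) hx
      filter_upwards [(hL q hq h0q).eventually (gt_mem_nhds hyx)] with n hn
      exact (hg n h0q ht.le hqt.le).trans_lt hn

end Helly

end Literature.Analysis.FunctionSpaces
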